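import Literature.NumberTheory.NumberFields.ScholzKummerGenerator
import Literature.NumberTheory.QuadraticFields.SquareRootGenerator
import HarnessLib

/-!
# The mirror field `ℚ(√-3d) = K(ζ₃)^{g}` of a quadratic field `K = ℚ(√d)` inside `K̄`

Topic `NumberTheory/NumberFields`.  Theorem-only file (no definition, no named fact).

For a quadratic field `K = ℚ(δ)`, `δ² = c ∈ ℚ`, not containing `ζ = ζ₃`, and `g ∈ Aut(K̄/ℚ)` with
`g|_K ≠ 1`, `g(ζ) = ζ²` (`exists_algEquiv_restrictNormal_ne_one`), the element `η = δ(1 + 2ζ)`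
(`(1 + 2ζ)² = -3`) generates the **mirror field** `ℚ(η) = ℚ(√-3c) ⊆ M = K(ζ)` of Scholz's
reflection theorem (Washington, *Introduction to Cyclotomic Fields*, Thm. 10.10: `L = ℚ(√d, √-3)`
with its three quadratic subfields `ℚ(√d)`, `ℚ(√-3)`, `F = ℚ(√-3d)`; `Gal(L/F) = ⟨στ⟩`):

* `restrictNormal_apply_eq_neg` — `g(δ) = -δ`;
* `apply_eta_eq`, `eta_sq`, `eta_not_mem_range` — `g(η) = η`, `η² = -3c`, `η ∉ ℚ`;
* `mem_adjoin_of_mem_adjoin_eta` — `ℚ(η) ⊆ M`;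
* `mem_adjoin_eta_of_apply_eq` — **`M^{g} ⊆ ℚ(η)`**: writing `x = (a + bδ) + (e + fδ)ζ`,
  `g(x) = x` forces `e = 0`, `f = 2b`, i.e. `x = a + bη`;
* `finrank_adjoin_eta`, `numberField_adjoin_eta` — `[ℚ(η):ℚ] = 2`.

These are the hypotheses `hkM`, `hMk` of `exists_kummer_generator` (`ScholzKummerGenerator.lean`).

## References

* L. C. Washington, *Introduction to Cyclotomic Fields*, GTM 83, 2nd ed. (1997), Thm. 10.10
  (proof). [Washington1997]
-/

noncomputable section

open NumberField Module
open scoped IntermediateField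

namespace Literature.NumberTheory.NumberFields

open Literature.NumberTheory.QuadraticFields.Quadratic

variable {K : Type} [Field K] [NumberField K] [IsGalois ℚ K] (h2 : finrank ℚ K = 2)
  {ζ : AlgebraicClosure K} (hζ : IsPrimitiveRoot ζ 3)
  (hζK : ζ ∉ Set.range (algebraMap K (AlgebraicClosure K)))
  {g : AlgebraicClosure K ≃ₐ[ℚ] AlgebraicClosure K} (hgK : g.restrictNormal K ≠ 1)
  (hgζ : g ζ = ζ ^ 2)
  {δ : K} {c : ℚ} (hδ : δ ∉ Set.range (algebraMap ℚ K)) (hδc : δ ^ 2 = algebraMap ℚ K c)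

omit [NumberField K] [IsGalois ℚ K] in
include hζ hζK in
/-- `ζ² = -ζ - 1`. [folklore] -/
theorem zeta_sq_eq : ζ ^ 2 = -ζ - 1 := by
  have h1 := minpoly.aeval K ζ
  rw [minpoly_eq hζ hζK] at h1
  simp only [map_add, map_pow, Polynomial.aeval_X, map_one] at h1
  linear_combination h1

omit [NumberField K] [IsGalois ℚ K] in
include hζ hζK in
/-- `(1 + 2ζ)² = -3`. [folklore] -/
theorem one_add_two_mul_zeta_sq : (1 + 2 * ζ) ^ 2 = -3 := by
  rw [add_sq, mul_pow, ← mul_assoc, zeta_sq_eq hζ hζK]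
  ring

omit [IsGalois ℚ K] in
include h2 hδ in
/-- `ℚ(δ) = K`. [folklore] -/
theorem adjoin_delta_eq_top : ℚ⟮δ⟯ = ⊤ := by
  have hdvd : finrank ℚ ℚ⟮δ⟯ ∣ 2 := by
    have h := IntermediateField.finrank_dvd_of_le_right (le_top : ℚ⟮δ⟯ ≤ ⊤)
    rwa [IntermediateField.finrank_top', h2] at h
  have hne : finrank ℚ ℚ⟮δ⟯ ≠ 1 := fun h1 => by
    rw [IntermediateField.finrank_adjoin_simple_eq_one_iff, IntermediateField.mem_bot] at h1
    exact hδ h1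
  haveI : FiniteDimensional ℚ K := Module.finite_of_finrank_eq_succ h2
  apply IntermediateField.eq_of_le_of_finrank_eq le_top
  rw [IntermediateField.finrank_top', h2]
  rcases (Nat.dvd_prime Nat.prime_two).mp hdvd with h | h
  · exact absurd h hne
  · exact h

include h2 hgK hδ hδc in
/-- **`g(δ) = -δ`**: `g|_K` is the non-trivial automorphism of `K = ℚ(δ)`, and `g(δ)² = δ²`.
[folklore] -/
theorem restrictNormal_apply_eq_neg : g.restrictNormal K δ = -δ := by
  set τ := g.restrictNormal K with hτ
  have hsq : (τ δ - δ) * (τ δ + δ) = 0 := by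
    have h : (τ δ) ^ 2 = δ ^ 2 := by rw [← map_pow, hδc, AlgEquiv.commutes]
    linear_combination h
  rcases mul_eq_zero.mp hsq with h | h
  · exfalso
    exact hgK (algEquiv_eq_one_of_apply_eq (adjoin_delta_eq_top h2 hδ) τ (sub_eq_zero.mp h))
  · linear_combination h

include h2 hζ hζK hgK hgζ hδ hδc in
/-- **`g(η) = η`** for `η = δ(1 + 2ζ)`: `g(δ) = -δ` and `g(1 + 2ζ) = 1 + 2ζ² = -(1 + 2ζ)`.
[folklore] -/
theorem apply_eta_eq :
    g (algebraMap K (AlgebraicClosure K) δ * (1 + 2 * ζ)) =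
      algebraMap K (AlgebraicClosure K) δ * (1 + 2 * ζ) := by
  rw [map_mul, ← AlgEquiv.restrictNormal_commutes, restrictNormal_apply_eq_neg h2 hgK hδ hδc,
    map_neg, map_add, map_one, map_mul, map_ofNat, hgζ, zeta_sq_eq hζ hζK]
  ring

omit [IsGalois ℚ K] in
include hζ hζK hδc in
/-- **`η² = -3c`**. [folklore] -/
theorem eta_sq :
    (algebraMap K (AlgebraicClosure K) δ * (1 + 2 * ζ)) ^ 2 =
      algebraMap ℚ (AlgebraicClosure K) (-3 * c) := by
  rw [mul_pow, ← map_pow, hδc, one_add_two_mul_zeta_sq hζ hζK, map_mul, map_neg, map_ofNat,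
    ← IsScalarTower.algebraMap_apply]
  ring

omit [IsGalois ℚ K] in
include hζK hδ in
/-- **`η ∉ ℚ`** (otherwise `1 + 2ζ ∈ K`, so `ζ ∈ K`). [folklore] -/
theorem eta_not_mem_range :
    algebraMap K (AlgebraicClosure K) δ * (1 + 2 * ζ) ∉
      Set.range (algebraMap ℚ (AlgebraicClosure K)) := by
  rintro ⟨q, hq⟩
  have hδ0 : δ ≠ 0 := ne_zero_of_not_mem_range hδ
  have hδ0' : algebraMap K (AlgebraicClosure K) δ ≠ 0 := (map_ne_zero _).mpr hδ0
  apply hζK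
  refine ⟨(algebraMap ℚ K q / δ - 1) / 2, ?_⟩
  rw [map_div₀, map_sub, map_one, map_div₀, map_ofNat, ← IsScalarTower.algebraMap_apply, hq]
  field_simp
  ring

omit [IsGalois ℚ K] in
/-- `ℚ(η) ⊆ K(ζ)`. [folklore] -/
theorem mem_adjoin_of_mem_adjoin_eta {x : AlgebraicClosure K}
    (hx : x ∈ ℚ⟮algebraMap K (AlgebraicClosure K) δ * (1 + 2 * ζ)⟯) : x ∈ K⟮ζ⟯ := by
  have h2M : (2 : AlgebraicClosure K) ∈ K⟮ζ⟯ := by exact_mod_cast K⟮ζ⟯.natCast_mem 2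
  have hη : algebraMap K (AlgebraicClosure K) δ * (1 + 2 * ζ) ∈ (K⟮ζ⟯).restrictScalars ℚ := by
    rw [IntermediateField.mem_restrictScalars]
    exact mul_mem (IntermediateField.algebraMap_mem _ δ)
      (add_mem (one_mem _) (mul_mem h2M (IntermediateField.mem_adjoin_simple_self K ζ)))
  have hle := IntermediateField.adjoin_simple_le_iff.mpr hη
  exact (IntermediateField.mem_restrictScalars ℚ).mp (hle hx)

include h2 hζ hζK hgK hgζ hδ hδc in
/-- **`K(ζ)^{g} ⊆ ℚ(η)`**: for `x = (a + bδ) + (e + fδ)ζ ∈ K(ζ)` (`a, b, e, f ∈ ℚ`),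
`g(x) = (a - bδ) + (e - fδ)ζ²`, and `g(x) = x` gives `e(1 + 2ζ) = (f - 2b)δ`, whence `e = 0`
(else `ζ ∈ K`) and `f = 2b`, i.e. `x = a + b·δ(1 + 2ζ) = a + bη`. [folklore] -/
theorem mem_adjoin_eta_of_apply_eq {x : AlgebraicClosure K} (hx : x ∈ K⟮ζ⟯) (hgx : g x = x) :
    x ∈ ℚ⟮algebraMap K (AlgebraicClosure K) δ * (1 + 2 * ζ)⟯ := by
  -- coordinates over `K`: `x = p + q ζ`, `p = a + b δ`, `q = e + f δ`
  have hM2 : finrank K K⟮ζ⟯ = 2 := finrank_adjoin_eq_two hζ hζK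
  set zM : K⟮ζ⟯ := ⟨ζ, IntermediateField.mem_adjoin_simple_self K ζ⟩ with hzM
  have hzK : zM ∉ Set.range (algebraMap K K⟮ζ⟯) := by
    rintro ⟨y, hy⟩
    exact hζK ⟨y, congrArg Subtype.val hy⟩
  obtain ⟨p, q, hpq⟩ := exists_eq_add_mul hM2 hzK ⟨x, hx⟩
  have hxΩ : x = algebraMap K (AlgebraicClosure K) p + algebraMap K (AlgebraicClosure K) q * ζ :=
    congrArg Subtype.val hpq
  obtain ⟨a, b, hp⟩ := exists_eq_add_mul h2 hδ p
  obtain ⟨e, f, hq⟩ := exists_eq_add_mul h2 hδ q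
  have hτ := restrictNormal_apply_eq_neg h2 hgK hδ hδc
  have hsc : ∀ r : ℚ, algebraMap K (AlgebraicClosure K) (algebraMap ℚ K r) =
      algebraMap ℚ (AlgebraicClosure K) r :=
    fun r => (IsScalarTower.algebraMap_apply ℚ K (AlgebraicClosure K) r).symm
  set D : AlgebraicClosure K := algebraMap K (AlgebraicClosure K) δ with hD
  have hD0 : D ≠ 0 := (map_ne_zero _).mpr (ne_zero_of_not_mem_range hδ)
  have hgp : g (algebraMap K (AlgebraicClosure K) p) =
      algebraMap ℚ (AlgebraicClosure K) a - algebraMap ℚ (AlgebraicClosure K) b * D := by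
    rw [← AlgEquiv.restrictNormal_commutes, hp, map_add, map_mul, AlgEquiv.commutes,
      AlgEquiv.commutes, hτ, map_add, map_mul, map_neg, hsc, hsc]
    ring
  have hgq : g (algebraMap K (AlgebraicClosure K) q) =
      algebraMap ℚ (AlgebraicClosure K) e - algebraMap ℚ (AlgebraicClosure K) f * D := by
    rw [← AlgEquiv.restrictNormal_commutes, hq, map_add, map_mul, AlgEquiv.commutes,
      AlgEquiv.commutes, hτ, map_add, map_mul, map_neg, hsc, hsc]
    ring
  have hxexp : x = (algebraMap ℚ (AlgebraicClosure K) a + algebraMap ℚ (AlgebraicClosure K) b * D) +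
      (algebraMap ℚ (AlgebraicClosure K) e + algebraMap ℚ (AlgebraicClosure K) f * D) * ζ := by
    rw [hxΩ, hp, hq, map_add, map_mul, map_add, map_mul, hsc, hsc, hsc, hsc]
  have hgxexp : g x = (algebraMap ℚ (AlgebraicClosure K) a - algebraMap ℚ (AlgebraicClosure K) b * D) +
      (algebraMap ℚ (AlgebraicClosure K) e - algebraMap ℚ (AlgebraicClosure K) f * D) * ζ ^ 2 := by
    rw [hxΩ, map_add, map_mul, hgp, hgq, hgζ]
  have hζ2 := zeta_sq_eq hζ hζK
  -- `g x = x` ⟹ `e (1 + 2ζ) = (f - 2b) δ`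
  have key : algebraMap ℚ (AlgebraicClosure K) e * (1 + 2 * ζ) =
      (algebraMap ℚ (AlgebraicClosure K) f - 2 * algebraMap ℚ (AlgebraicClosure K) b) * D := by
    have h : g x - x = 0 := sub_eq_zero.mpr hgx
    rw [hgxexp, hxexp, hζ2] at h
    linear_combination -h
  by_cases he : e = 0
  · -- `f = 2b` and `x = a + b η`
    have he0 : algebraMap ℚ (AlgebraicClosure K) e = 0 := by rw [he, map_zero]
    rw [he0, zero_mul] at key
    have hfb : algebraMap ℚ (AlgebraicClosure K) f = 2 * algebraMap ℚ (AlgebraicClosure K) b := by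
      have h := (mul_eq_zero.mp key.symm).resolve_right hD0
      linear_combination h
    have hxη : x = algebraMap ℚ (AlgebraicClosure K) a +
        algebraMap ℚ (AlgebraicClosure K) b * (D * (1 + 2 * ζ)) := by
      rw [hxexp, he0, hfb]
      ring
    rw [hxη]
    exact add_mem (IntermediateField.algebraMap_mem _ a)
      (mul_mem (IntermediateField.algebraMap_mem _ b) (IntermediateField.mem_adjoin_simple_self ℚ _))
  · -- `e ≠ 0` would put `ζ` in `K`
    exfalso
    apply hζK
    have he0 : algebraMap ℚ (AlgebraicClosure K) e ≠ 0 := (map_ne_zero _).mpr he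
    refine ⟨((algebraMap ℚ K f - 2 * algebraMap ℚ K b) / algebraMap ℚ K e * δ - 1) / 2, ?_⟩
    rw [map_div₀, map_sub, map_one, map_ofNat, map_mul, map_div₀, map_sub, map_mul, map_ofNat,
      hsc, hsc, hsc]
    have h12 : (1 + 2 * ζ : AlgebraicClosure K) =
        (algebraMap ℚ (AlgebraicClosure K) f - 2 * algebraMap ℚ (AlgebraicClosure K) b) /
          algebraMap ℚ (AlgebraicClosure K) e * D := by
      rw [div_mul_eq_mul_div, eq_div_iff he0, mul_comm]
      exact key
    rw [← h12]
    ring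

omit [IsGalois ℚ K] in
include hζ hζK hδ hδc in
/-- **`[ℚ(η) : ℚ] = 2`** (`η² = -3c ∈ ℚ`, `η ∉ ℚ`). [folklore] -/
theorem finrank_adjoin_eta :
    finrank ℚ ℚ⟮algebraMap K (AlgebraicClosure K) δ * (1 + 2 * ζ)⟯ = 2 := by
  haveI := isAlgClosure_rat_algebraicClosure (K := K)
  set η := algebraMap K (AlgebraicClosure K) δ * (1 + 2 * ζ) with hη
  have hint : IsIntegral ℚ η := (Algebra.IsAlgebraic.isAlgebraic η).isIntegral
  rw [IntermediateField.adjoin.finrank hint]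
  apply le_antisymm
  · have hP : (Polynomial.X ^ 2 - Polynomial.C (-3 * c) : Polynomial ℚ) ≠ 0 := by
      apply Polynomial.Monic.ne_zero
      monicity!
    have hroot : Polynomial.aeval η (Polynomial.X ^ 2 - Polynomial.C (-3 * c) : Polynomial ℚ) = 0 := by
      simp only [map_sub, map_pow, Polynomial.aeval_X, Polynomial.aeval_C]
      rw [hη, eta_sq hζ hζK hδc, sub_self]
    have h2 : (Polynomial.X ^ 2 - Polynomial.C (-3 * c) : Polynomial ℚ).natDegree = 2 := by
      compute_degree!
    exact (Polynomial.natDegree_le_of_dvd (minpoly.dvd ℚ η hroot) hP).trans h2.le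
  · refine (minpoly.two_le_natDegree_iff hint).mpr fun h => eta_not_mem_range hζK hδ ?_
    obtain ⟨y, hy⟩ := RingHom.mem_range.mp h
    exact ⟨y, hy⟩

omit [IsGalois ℚ K] in
include hζ hζK hδ hδc in
/-- `ℚ(η)` is a number field. [folklore] -/
theorem numberField_adjoin_eta :
    NumberField ℚ⟮algebraMap K (AlgebraicClosure K) δ * (1 + 2 * ζ)⟯ := by
  haveI : FiniteDimensional ℚ ℚ⟮algebraMap K (AlgebraicClosure K) δ * (1 + 2 * ζ)⟯ :=
    Module.finite_of_finrank_eq_succ (finrank_adjoin_eta hζ hζK hδ hδc)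
  exact NumberField.of_module_finite ℚ _

end Literature.NumberTheory.NumberFields

end
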